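import Summits.CriticalPhenomena.PercolationContinuityZ3.Theorems.Transplant.FKConnectivityAllQAntipodalTwoSpinePhi
import HarnessLib

/-!
# Connectivity correlation inequalities for `φ_{w,q}` — TWO-SPINE word model: the LOWEST-λ (no-collision) LEMMA

Helper file (`--supports stmt-CriticalPhenomena-4575`), FK sub-lane `prim-bschramm-fk-2` (gen 15); builds on p205010 (kernel theorem,
internal audit signed; external expert review pending).  No named facts, no sorries, standard axioms.

Memo `bschramm/FROM-fk-2-g15-TWO-SPINE.md` §12 (V3) / blueprint L2.3.  In the two-spine RULE the atom targets have an ANTI-GROUND side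
(every free letter `ω = 10`; series letters with first bit `true`, parallel letters with second bit `false`) next to a PRESENT root.
**Lemma** (`phiRun_present_ne_of_lt_antiGround`): if `w` is anti-ground and `w' ≤ w` letterwise (flip order) with `w' ≠ w`, then Theorem U's
top-down run from a present root (type `10`) applied to `w'` does NOT give `w` — because below the lowest `λ` of `w'` the composite stays
`10`, so that `λ` is never flipped.  Hence whole-cell targets `Φ_N(ℓ')` and atom targets never coincide (no collision).
[cite: Grimmett2006, §3.8 (pp. 61–62); §3.9 (p. 63)]
-/

namespace Summit.CriticalPhenomena.PercolationContinuityZ3.Theorems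

namespace FK

namespace TwoSpine

open X2Word

/-- An ANTI-GROUND letter (the swap of a ground letter): series with first bit `true` (`10` or inert `11`), parallel with second
bit `false` (`10` or inert `00`). [folklore] -/
def antiGroundLetter (l : SLetter) : Bool :=
  match l.1 with
  | .W => l.2.1
  | .P => !l.2.2

/-- An ANTI-GROUND word. [folklore] -/
def isAntiGround (w : List SLetter) : Bool := w.all antiGroundLetter

/-- Through an anti-ground letter the present-root composite `10` stays `10`. [folklore] -/
theorem compStep_present_antiGround {l : SLetter} (h : antiGroundLetter l = true) : compStep (true, false) l = (true, false) := by
  obtain ⟨k, b, bb⟩ := l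
  cases k <;> cases b <;> cases bb <;> simp_all [compStep, antiGroundLetter]

/-- A `λ`-letter met with composite `10` below it is not flipped: the new composite is `00` (series) or `11` (parallel), not `01`. [folklore] -/
theorem is01_compStep_present_lambda (k : Kind) : is01 (compStep (true, false) (k, false, true)) = false := by
  cases k <;> simp [compStep, is01]

/-- An anti-ground letter is not a `λ`. [folklore] -/
theorem antiGroundLetter_ne_lambda {l : SLetter} (h : antiGroundLetter l = true) : l.2 ≠ (false, true) := by
  obtain ⟨k, b, bb⟩ := l
  cases k <;> cases b <;> cases bb <;> simp_all [antiGroundLetter]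

/-- **Lowest-λ lemma (no collision, memo §12 V3)**: from a PRESENT root, Theorem U's run applied to a word strictly below an anti-ground
word `w` (in the letterwise flip order `01 → 10` of gen 14's `fiberSum_le_of_flip`) never produces `w`. [folklore] -/
theorem phiRun_present_ne_of_lt_antiGround {w w' : List SLetter} (hw : isAntiGround w = true)
    (hle : List.Forall₂ (fun a b : SLetter => b = a ∨ (a.2 = (false, true) ∧ b = (a.1, true, false))) w' w) (hne : w' ≠ w) :
    phiRun (true, false) w' ≠ w := by
  induction hle with
  | nil => exact absurd rfl hne
  | @cons a b w' w hab hrest ih =>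
    have hb : antiGroundLetter b = true := by simp [isAntiGround] at hw; exact hw.1
    have hw2 : isAntiGround w = true := by simp [isAntiGround] at hw ⊢; exact hw.2
    rw [phiRun_cons]
    rcases hab with rfl | ⟨ha2, rfl⟩
    · -- equal heads: the composite stays `10`, recurse on the tails
      have hne' : w' ≠ w := fun h => hne (by rw [h])
      rw [compStep_present_antiGround hb]
      intro h
      exact ih hw2 hne' (List.cons.inj h).2
    · -- the lowest λ: it is not flipped, so the heads differ
      obtain ⟨k, b2, bb2⟩ := a
      simp only [Prod.mk.injEq] at ha2
      obtain ⟨rfl, rfl⟩ := ha2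
      have hc : is01 (compStep (true, false) (k, false, true)) = false := is01_compStep_present_lambda k
      simp [hc]

end TwoSpine

end FK

end Summit.CriticalPhenomena.PercolationContinuityZ3.Theorems
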